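import Summits.QuantumFields.YangMills.Theorems.BalabanUVNodesN19DensityRoad
import Literature.MathematicalPhysics.QuantumFieldTheory.King1986.CompositionLaw
import Literature.MathematicalPhysics.QuantumFieldTheory.King1986.CovarianceRateTorus

/-!
# BalabanUVNodes ∕ node N18 (NE5 bracket) — SHAPE_cl (the vacuum class-density sandwich DENS_cl⁰) PRODUCED AT THE KING-MODEL LEVEL from Proposition 3.10
# (3.91) in operator ∕ symbol form, and FED BY NAME into N19's dressed `Spine.NE7.Core` and N14's binder `TiltedMeanMatching` (n19-d's `…N19DensityRoad`)

Cell `pub-ymgap`, HUMAN RULING D-0062 (Track A), R134 ACCELERATION seat `pub-ymgap-dag-n14-c` RE-POINTED to **N18-b** (dag-lead REBALANCE №67, pub-ymgap INBOX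
2026-08-27T05:39Z: «NE5's output-rate-as-functional-of-V storey that feeds SHAPE_cl ∕ N19 U3 by name … the output-rate functional that PRODUCES SHAPE_cl at the King-model ∕
cluster-output level»), generation 6; route `Summits/QuantumFields/YangMills/Theses/BalabanUVNodes.lean` rev 18∕19 (cluster K3⁗ `SpineGivenEndpointR13Sep` =
stmt-QuantumFields-20292, `--supports … --as helper`); venue ruling R424 (`YangMills/Theorems`, namespace `YMDAG.N18.KingModelDens`).  ADDITIVE — imports n19-d's module 27
`…N19DensityRoad` (lens decomp v7 §B lifted: `core_dressed_of_vacuumDens`, `tiltedMeanMatching_of_vacuumDens` — CONSUMED BY NAME, their FIRST INSTANCE) and the tree's King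
files `King1986/CompositionLaw` (`DeltaEff`, `aK`, ★ `lemma43_aK` = Prop. 3.10 (3.91) ∕ Lemma 4.3 (4.18) with explicit constant, `DeltaEff_le`, `DeltaEff_pos`, `aK_le`),
`King1986/GaussianNormalizationRate` ((3.92): `abs_sum_sub_mul_le`; `thetaK`) and `King1986/CovarianceRateTorus` (`thetaK_le`, `thetaBar`, `aminL_pos`) — CITED, nothing of them
re-proved; THEOREMS ONLY (0 `def`), modifies nothing.

THE JUNCTION TYPED HERE (trigger census, pub-ymgap INBOX N18B-STARTED line).  At the E-functional level the King model's U3 content is in the tree (n18-a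
`…N18KingModelU3.u3Target_of_kingModel`; n18-e `…N18KingModelTorus(MassUniform)`); at the template level the U3 → NE7 chain is in the tree (`T4TowerRateDischarge`,
`T4Termwise*`); the two printed halves of King's unit-lattice statement are in the tree at the SYMBOL level ((3.91) `lemma43_aK`, (3.92) `king392_shape`, (3.93) `king393_aK`).
What was not: the MEASURE-LEVEL statement the spine reads — lens v7's DENS_cl⁰, the pointwise sandwich of the two runs' unit-lattice EFFECTIVE GAUSSIAN DENSITIES
`e^{−⟨ψ,Δ^{(k)}ψ⟩/2}`, `e^{−⟨ψ,Δ^{(k+n)}ψ⟩/2}` on the small-field classes with a SUMMABLE radius — and its two consequences BY NAME: N19's dressed `Core` (every source `t`)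
and N14's binder.  That is this file:
* §1 [folklore] QUADRATIC ACTIONS ON THE UNIT-LATTICE FIELD SPACE `E` (a real inner-product space; the two runs' effective Laplacians `ΔA K, ΔB K : E →L[ℝ] E` at run
  length `K`; vacuum densities `exp(−⟪ψ, ΔX K ψ⟫/2)` on `t`-free reference pieces `μ K τ` carried by the small-field class `‖ψ‖² ≤ M` — King's (3.2) `|A_k(x)| ≤ p·μ₀⁻¹` at the
  unit scale gives `M = (p/μ₀)²·|T|`): `abs_half_inner_sub_le`, `exp_neg_sandwich_of_abs_sub_le`, ★ **`vacuumDens_of_operatorRate`** (HYPOTHESIS = (3.91) IN OPERATOR FORM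
  `|⟪ψ,(ΔA K − ΔB K)ψ⟫| ≤ θ_K·⟪ψ, ΔA K ψ⟫`, `⟪ψ, ΔA K ψ⟫ ≤ a‖ψ‖²` ⇒ DENS_cl⁰ with centre `0` and radius `r_K ≥ θ_K·a·M/2`), ★★ **`core_kingModel_of_operatorRate`** (⇒
  `Spine.NE7.Core l₀ vol T Bad P Q δ` for the DRESSED class partition functions `P = ∫ e^{−⟪ψ,ΔAψ⟫/2}·e^{tW} dμ`, `Q` likewise, EVERY `t`, any `vol·δ_K ≥ r_K` — ONE application of
  `core_dressed_of_vacuumDens`), ★★ **`tiltedMeanMatching_kingModel_of_operatorRate`** (⇒ `TiltedMeanMatching … (K ↦ B(e^{2r_K} − 1))` for every `B`-bounded unit-scale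
  observable — ONE application of `tiltedMeanMatching_of_vacuumDens`).
* §2 [folklore] FROM SYMBOLS (King's Fourier-diagonal form ⇒ the operator form): `inner_apply_eq_sum_symbol` (`⟪ψ, Δψ⟫ = Σ_p λ(p)·⟪b_p, ψ⟫²` for `Δ` diagonal in an orthonormal
  basis `b` in the weak sense `⟪b_p, Δψ⟫ = λ(p)⟪b_p, ψ⟫`), ★ **`operatorRate_of_symbolRate`** ((3.91) SYMBOL FORM `|λA(p) − λB(p)| ≤ θ·λA(p)`, `0 ≤ λA ≤ a` ⇒ the three
  operator hypotheses of §1 — King's step (3.92); `GaussianNormalizationRate.abs_sum_sub_mul_le` CITED).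
* §3 [cite ∘ folklore] KING'S SYMBOLS BY NAME: `kingTheta_nonneg`, ★ **`symbolRate_kingDeltaEff`** (`λA = DeltaEff (aK a L k) (L^k) m p`, `λB = DeltaEff (aK a L (k+n)) (L^n·L^k) m p` at
  nonzero Brillouin-zone momenta ⇒ the symbol form with King's `θ_k = thetaK a L k n = 2a_k((a_n)⁻¹ + π²/48 + 1/3)·(L^k)⁻²` (`GaussianNormalizationRate.thetaK`) and
  `a` — `lemma43_aK` + `DeltaEff_le`∕`_pos` + `aK_le`, nothing re-proved), `summable_geometric_radius`, ★★ **`vacuumDens_kingModel`** (END TO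
  END: King's two runs `k_K`, `k_K+n` read on the unit lattice through a common Fourier basis ⇒ DENS_cl⁰ with the radius `θ_{k_K}·a·M/2` = the hypothesis `hD` of n19-d's two theorems,
  INHABITED), ★★ **`tiltedMeanMatching_kingModel`** (N14's binder in the printed model, end to end), ★ **`summable_kingRadius`** (`k_K = K + 1`: `Σ_K r_K < ∞` — N19's `Summable δ`
  at `δ_K = r_K/vol` — and `Σ_K B(e^{2r_K} − 1) < ∞` — N14's `Summable η` — by the tree's GEOMETRIC bound `CovarianceRateTorus.thetaK_le` `θ_k ≤ θ̄·L^{−2k}`, CITED): the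
  programme's N19 ∕ N14 statements PRODUCED in the printed model.

HONEST FRAMING.  King's `A = 0` scalar MODEL ([King1986] §3.6 Prop. 3.10 p. 669, §4 pp. 670–672; template literature for d = 2, 3 — the algebra here is dimension-free) —
NOT Bałaban's non-abelian class densities, for which DENS_cl⁰ = NE7 proper is NOT PRINTED and its producers are NODE O ∕ U3 objects; the zero mode is excluded exactly as in
`GaussianNormalizationRate` (§4 there; a massive zero mode obeys the same relative rate — said, not typed); the reference pieces `μ K τ`, the class index and the observable
are PARAMETERS (the small-field class enters only through `‖ψ‖² ≤ M` a.e.).  Everything is PROVED (0 `sorry`, 0 named facts); count-neutral; N18 ∕ N19 ∕ N14 NOT discharged;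
counts UNMOVED.  One finite four-torus programme at fixed ε; NOT ℝ⁴, NOT OS, NOT a mass gap, NOT Clay.
-/

noncomputable section

namespace YMDAG.N18.KingModelDens

open MeasureTheory Set Filter Finset Real
open scoped ENNReal RealInnerProductSpace BigOperators
open Summit.QuantumFields.BalabanUV.T4Continuum.NE1p.DressedMGFForm (TiltedMeanMatching)
open Summit.QuantumFields.BalabanUV.T4Continuum.Spine.NE7 (Core)
open Summit.QuantumFields.YangMills.BalabanUVNodes.N19DensityRoad (core_dressed_of_vacuumDens tiltedMeanMatching_of_vacuumDens)
open Literature.MathematicalPhysics.QuantumFieldTheory.King1986 (DeltaEff aK momSq thetaK lemma43_aK DeltaEff_le DeltaEff_pos aK_le aK_pos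
  abs_sum_sub_mul_le)
open Literature.MathematicalPhysics.QuantumFieldTheory.King1986.Torus (thetaBar aminL aminL_pos thetaK_le)

/-! ## §1 Quadratic actions on the unit-lattice field space: (3.91) in operator form ⇒ DENS_cl⁰ ⇒ dressed `Core` and N14's binder, by name -/
section Operator

variable {E : Type*} [NormedAddCommGroup E] [InnerProductSpace ℝ E]

/-- Pointwise: under the operator form of (3.91) and `Δ^A ≤ a`, the two quadratic actions differ by `≤ θ·a·‖ψ‖²/2`. [folklore] -/
theorem abs_half_inner_sub_le {ΔA ΔB : E →L[ℝ] E} {θ a : ℝ} (hθ : 0 ≤ θ) (hrel : ∀ ψ, |⟪ψ, ΔA ψ - ΔB ψ⟫| ≤ θ * ⟪ψ, ΔA ψ⟫)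
    (hbd : ∀ ψ, ⟪ψ, ΔA ψ⟫ ≤ a * ‖ψ‖ ^ 2) (ψ : E) : |⟪ψ, ΔA ψ⟫ / 2 - ⟪ψ, ΔB ψ⟫ / 2| ≤ θ * a * ‖ψ‖ ^ 2 / 2 := by
  have h1 : |⟪ψ, ΔA ψ⟫ - ⟪ψ, ΔB ψ⟫| ≤ θ * (a * ‖ψ‖ ^ 2) :=
    (by rw [← inner_sub_right] : |⟪ψ, ΔA ψ⟫ - ⟪ψ, ΔB ψ⟫| = |⟪ψ, ΔA ψ - ΔB ψ⟫|) ▸ (hrel ψ).trans (mul_le_mul_of_nonneg_left (hbd ψ) hθ)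
  rw [← sub_div, abs_div, abs_two]
  linarith

/-- Pointwise: `|sA − sB| ≤ r` sandwiches the Boltzmann factors, `e^{0−r}·e^{−sA} ≤ e^{−sB} ≤ e^{0+r}·e^{−sA}`. [folklore] -/
theorem exp_neg_sandwich_of_abs_sub_le {sA sB r : ℝ} (h : |sA - sB| ≤ r) :
    Real.exp (0 - r) * Real.exp (-sA) ≤ Real.exp (-sB) ∧ Real.exp (-sB) ≤ Real.exp (0 + r) * Real.exp (-sA) := by
  obtain ⟨h1, h2⟩ := abs_le.1 h
  constructor
  · rw [← Real.exp_add]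
    exact Real.exp_le_exp.2 (by linarith)
  · rw [← Real.exp_add]
    exact Real.exp_le_exp.2 (by linarith)

variable [MeasurableSpace E] [BorelSpace E] {ι : Type*} [DecidableEq ι] {l₀ vol B a M : ℝ} {T : ℕ → Finset ι} {Bad : ℕ → ℝ → Finset ι}
  {W : ℕ → E → ℝ} {μ : ℕ → ι → Measure E} {ΔA ΔB : ℕ → E →L[ℝ] E} {θ r δ : ℕ → ℝ} {P Q : ℕ → ℝ → ι → ℝ}

omit [BorelSpace E] in
/-- **★ DENS_cl⁰ IN THE QUADRATIC (KING) MODEL FROM (3.91) IN OPERATOR FORM** [folklore]: if for every run length `K` the two runs' unit-lattice effective Laplacians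
satisfy `|⟪ψ,(ΔA K − ΔB K)ψ⟫| ≤ θ_K·⟪ψ, ΔA K ψ⟫` and `⟪ψ, ΔA K ψ⟫ ≤ a‖ψ‖²`, and the reference pieces of the good classes are carried by the small-field class `‖ψ‖² ≤ M`,
then the vacuum densities `e^{−⟪ψ,ΔX K ψ⟫/2}` are pointwise sandwiched with ONE centre (`0`) and radius `r_K ≥ θ_K·a·M/2` — lens v7's DENS_cl⁰, inhabited. -/
theorem vacuumDens_of_operatorRate (hθ : ∀ K, 0 ≤ θ K) (hrel : ∀ K ψ, |⟪ψ, ΔA K ψ - ΔB K ψ⟫| ≤ θ K * ⟪ψ, ΔA K ψ⟫)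
    (hbd : ∀ K ψ, ⟪ψ, ΔA K ψ⟫ ≤ a * ‖ψ‖ ^ 2) (ha : 0 ≤ a)
    (hsupp : ∀ (K : ℕ) (t : ℝ), |t| ≤ l₀ → ∀ τ ∈ T K \ Bad K t, ∀ᵐ ψ ∂(μ K τ), ‖ψ‖ ^ 2 ≤ M) (hr : ∀ K, θ K * a * M / 2 ≤ r K) :
    ∀ K : ℕ, ∃ c : ℝ, ∀ t : ℝ, |t| ≤ l₀ → ∀ τ ∈ T K \ Bad K t, ∀ᵐ ψ ∂(μ K τ),
      Real.exp (c - r K) * Real.exp (-(⟪ψ, ΔA K ψ⟫ / 2)) ≤ Real.exp (-(⟪ψ, ΔB K ψ⟫ / 2)) ∧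
        Real.exp (-(⟪ψ, ΔB K ψ⟫ / 2)) ≤ Real.exp (c + r K) * Real.exp (-(⟪ψ, ΔA K ψ⟫ / 2)) := by
  intro K
  refine ⟨0, fun t ht τ hτ => (hsupp K t ht τ hτ).mono fun ψ hψ => ?_⟩
  refine exp_neg_sandwich_of_abs_sub_le ((abs_half_inner_sub_le (hθ K) (hrel K) (hbd K) ψ).trans ((?_ : θ K * a * ‖ψ‖ ^ 2 / 2 ≤ θ K * a * M / 2).trans (hr K)))
  have : θ K * a * ‖ψ‖ ^ 2 ≤ θ K * a * M := mul_le_mul_of_nonneg_left hψ (mul_nonneg (hθ K) ha)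
  linarith

/-- Measurability of a quadratic action's Boltzmann factor. [folklore] -/
theorem measurable_exp_neg_half_inner (Δ : E →L[ℝ] E) : Measurable fun ψ : E => Real.exp (-(⟪ψ, Δ ψ⟫ / 2)) :=
  (Real.continuous_exp.comp ((continuous_id.inner Δ.continuous).div_const 2).neg).measurable

/-- On a finite reference piece the Boltzmann factor of a nonnegative quadratic action is integrable (it is `≤ 1`). [folklore] -/
theorem integrable_exp_neg_half_inner {ν : Measure E} [IsFiniteMeasure ν] {Δ : E →L[ℝ] E} (hpos : ∀ ψ, 0 ≤ ⟪ψ, Δ ψ⟫) :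
    Integrable (fun ψ : E => Real.exp (-(⟪ψ, Δ ψ⟫ / 2))) ν := by
  refine (integrable_const (1 : ℝ)).mono' (measurable_exp_neg_half_inner Δ).aestronglyMeasurable (Eventually.of_forall fun ψ => ?_)
  rw [Real.norm_eq_abs, abs_of_pos (Real.exp_pos _), Real.exp_le_one_iff]
  linarith [hpos ψ]

/-- **★★ THE DRESSED `Core` IN THE KING MODEL, EVERY SOURCE `t`** [folklore ∘ n19-d `core_dressed_of_vacuumDens`]: under the hypotheses of `vacuumDens_of_operatorRate`, with
`ΔA, ΔB ≥ 0`, finite reference pieces on the classes, a `B`-bounded measurable unit-scale observable family `W`, and the dressed class partition functions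
`P K t τ = ∫ e^{−⟪ψ,ΔA K ψ⟫/2}·e^{tW_K ψ} dμ_{K,τ}`, `Q` likewise with `ΔB`: `Spine.NE7.Core l₀ vol T Bad P Q δ` for any `δ` with `r_K ≤ vol·δ_K`. -/
theorem core_kingModel_of_operatorRate (hθ : ∀ K, 0 ≤ θ K) (hrel : ∀ K ψ, |⟪ψ, ΔA K ψ - ΔB K ψ⟫| ≤ θ K * ⟪ψ, ΔA K ψ⟫)
    (hbd : ∀ K ψ, ⟪ψ, ΔA K ψ⟫ ≤ a * ‖ψ‖ ^ 2) (ha : 0 ≤ a) (hposA : ∀ K ψ, 0 ≤ ⟪ψ, ΔA K ψ⟫) (hposB : ∀ K ψ, 0 ≤ ⟪ψ, ΔB K ψ⟫)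
    (hsupp : ∀ (K : ℕ) (t : ℝ), |t| ≤ l₀ → ∀ τ ∈ T K \ Bad K t, ∀ᵐ ψ ∂(μ K τ), ‖ψ‖ ^ 2 ≤ M) (hr : ∀ K, θ K * a * M / 2 ≤ r K)
    (hfin : ∀ K, ∀ τ ∈ T K, IsFiniteMeasure (μ K τ)) (hB : 0 ≤ B) (hWm : ∀ K, Measurable (W K)) (hWb : ∀ K ψ, |W K ψ| ≤ B)
    (hP : ∀ K (t : ℝ), ∀ τ ∈ T K, P K t τ = ∫ ψ, Real.exp (-(⟪ψ, ΔA K ψ⟫ / 2)) * Real.exp (t * W K ψ) ∂(μ K τ))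
    (hQ : ∀ K (t : ℝ), ∀ τ ∈ T K, Q K t τ = ∫ ψ, Real.exp (-(⟪ψ, ΔB K ψ⟫ / 2)) * Real.exp (t * W K ψ) ∂(μ K τ))
    (hδ : ∀ K, r K ≤ vol * δ K) : Core l₀ vol T Bad P Q δ :=
  core_dressed_of_vacuumDens (Ω := fun _ => E) (μ := μ) (fA := fun K _ ψ => Real.exp (-(⟪ψ, ΔA K ψ⟫ / 2)))
    (fB := fun K _ ψ => Real.exp (-(⟪ψ, ΔB K ψ⟫ / 2))) hB hWm hWb (fun K _ => measurable_exp_neg_half_inner (ΔA K))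
    (fun K _ ψ => (Real.exp_pos _).le) (fun K τ hτ => by haveI := hfin K τ hτ; exact integrable_exp_neg_half_inner (hposA K))
    (fun K _ => measurable_exp_neg_half_inner (ΔB K)) (fun K _ ψ => (Real.exp_pos _).le)
    (fun K τ hτ => by haveI := hfin K τ hτ; exact integrable_exp_neg_half_inner (hposB K)) hP hQ
    (vacuumDens_of_operatorRate hθ hrel hbd ha hsupp hr) hδ

/-- **★★ N14's BINDER IN THE KING MODEL** [folklore ∘ n19-d `tiltedMeanMatching_of_vacuumDens`]: under the same operator hypotheses (and `ΔA ≥ 0` for finiteness), for every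
`B`-bounded measurable unit-scale observable family the two runs' dressed class laws `μ_{K,τ}.withDensity e^{−⟪ψ,ΔX K ψ⟫/2}` satisfy
`TiltedMeanMatching l₀ T Bad W (run A) W (run B) (K ↦ B·(e^{2 r_K} − 1))`. -/
theorem tiltedMeanMatching_kingModel_of_operatorRate (hθ : ∀ K, 0 ≤ θ K) (hrel : ∀ K ψ, |⟪ψ, ΔA K ψ - ΔB K ψ⟫| ≤ θ K * ⟪ψ, ΔA K ψ⟫)
    (hbd : ∀ K ψ, ⟪ψ, ΔA K ψ⟫ ≤ a * ‖ψ‖ ^ 2) (ha : 0 ≤ a) (hM : 0 ≤ M) (hposA : ∀ K ψ, 0 ≤ ⟪ψ, ΔA K ψ⟫)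
    (hsupp : ∀ (K : ℕ) (t : ℝ), |t| ≤ l₀ → ∀ τ ∈ T K \ Bad K t, ∀ᵐ ψ ∂(μ K τ), ‖ψ‖ ^ 2 ≤ M) (hr : ∀ K, θ K * a * M / 2 ≤ r K)
    (hfin : ∀ K, ∀ τ ∈ T K, IsFiniteMeasure (μ K τ)) (hB : 0 ≤ B) (hWm : ∀ K, Measurable (W K)) (hWb : ∀ K ψ, |W K ψ| ≤ B) :
    TiltedMeanMatching l₀ T Bad W (fun K τ => (μ K τ).withDensity fun ψ => ENNReal.ofReal (Real.exp (-(⟪ψ, ΔA K ψ⟫ / 2)))) W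
      (fun K τ => (μ K τ).withDensity fun ψ => ENNReal.ofReal (Real.exp (-(⟪ψ, ΔB K ψ⟫ / 2)))) fun K => B * (Real.exp (2 * r K) - 1) := by
  have hD := vacuumDens_of_operatorRate (μ := μ) hθ hrel hbd ha hsupp hr
  refine tiltedMeanMatching_of_vacuumDens (Ω := fun _ => E) (μ := μ) (fA := fun K _ ψ => Real.exp (-(⟪ψ, ΔA K ψ⟫ / 2)))
    (fB := fun K _ ψ => Real.exp (-(⟪ψ, ΔB K ψ⟫ / 2)))
    (fun K => (div_nonneg (mul_nonneg (mul_nonneg (hθ K) ha) hM) two_pos.le).trans (hr K)) hB hWm hWb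
    (fun K _ => measurable_exp_neg_half_inner (ΔA K)) (fun K _ => measurable_exp_neg_half_inner (ΔB K))
    (fun K τ hτ => by haveI := hfin K τ hτ; exact integrable_exp_neg_half_inner (hposA K)) fun K t ht τ hτ => ?_
  obtain ⟨c, hc⟩ := hD K
  exact ⟨c, hc t ht τ hτ⟩

end Operator

/-! ## §2 From symbols: the Fourier-diagonal form of (3.91) gives the operator form (King's step (3.92)) -/
section Symbol

variable {E : Type*} [NormedAddCommGroup E] [InnerProductSpace ℝ E] {P : Type*} [Fintype P]

/-- A map diagonal in an orthonormal basis (weak form `⟪b_p, Δψ⟫ = λ(p)·⟪b_p, ψ⟫`) has the quadratic form `⟪ψ, Δψ⟫ = Σ_p λ(p)·⟪b_p, ψ⟫²` (Parseval, Mathlib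
`OrthonormalBasis.sum_inner_mul_inner`). [folklore] -/
theorem inner_apply_eq_sum_symbol (b : OrthonormalBasis P ℝ E) {Δ : E →L[ℝ] E} {lam : P → ℝ} (hdiag : ∀ p ψ, ⟪b p, Δ ψ⟫ = lam p * ⟪b p, ψ⟫) (ψ : E) :
    ⟪ψ, Δ ψ⟫ = ∑ p, lam p * ⟪b p, ψ⟫ ^ 2 := by
  rw [← b.sum_inner_mul_inner ψ (Δ ψ)]
  refine Finset.sum_congr rfl fun p _ => ?_
  rw [hdiag p ψ, real_inner_comm (b p) ψ]
  ring

/-- **★ (3.91) IN SYMBOL FORM ⇒ THE OPERATOR FORM** [folklore; King's step (3.92), the tree's `GaussianNormalizationRate.abs_sum_sub_mul_le` CITED]: if both runs' effective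
Laplacians are diagonal in a COMMON orthonormal (Fourier) basis `b` with symbols `λA, λB`, `|λA(p) − λB(p)| ≤ θ·λA(p)`, `0 ≤ λA(p) ≤ a`, `0 ≤ λB(p)`, then
`|⟪ψ,(ΔA − ΔB)ψ⟫| ≤ θ·⟪ψ, ΔAψ⟫`, `⟪ψ, ΔAψ⟫ ≤ a‖ψ‖²`, `0 ≤ ⟪ψ, ΔAψ⟫`, `0 ≤ ⟪ψ, ΔBψ⟫` — the hypotheses of §1. -/
theorem operatorRate_of_symbolRate (b : OrthonormalBasis P ℝ E) {ΔA ΔB : E →L[ℝ] E} {lamA lamB : P → ℝ} {θ a : ℝ}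
    (hA : ∀ p ψ, ⟪b p, ΔA ψ⟫ = lamA p * ⟪b p, ψ⟫) (hB : ∀ p ψ, ⟪b p, ΔB ψ⟫ = lamB p * ⟪b p, ψ⟫)
    (hrel : ∀ p, |lamA p - lamB p| ≤ θ * lamA p) (ha : ∀ p, lamA p ≤ a) (h0A : ∀ p, 0 ≤ lamA p) (h0B : ∀ p, 0 ≤ lamB p) :
    (∀ ψ, |⟪ψ, ΔA ψ - ΔB ψ⟫| ≤ θ * ⟪ψ, ΔA ψ⟫) ∧ (∀ ψ, ⟪ψ, ΔA ψ⟫ ≤ a * ‖ψ‖ ^ 2) ∧ (∀ ψ, 0 ≤ ⟪ψ, ΔA ψ⟫) ∧ (∀ ψ, 0 ≤ ⟪ψ, ΔB ψ⟫) := by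
  have qA : ∀ ψ, ⟪ψ, ΔA ψ⟫ = ∑ p, lamA p * ⟪b p, ψ⟫ ^ 2 := inner_apply_eq_sum_symbol b hA
  have qB : ∀ ψ, ⟪ψ, ΔB ψ⟫ = ∑ p, lamB p * ⟪b p, ψ⟫ ^ 2 := inner_apply_eq_sum_symbol b hB
  refine ⟨fun ψ => ?_, fun ψ => ?_, fun ψ => ?_, fun ψ => ?_⟩
  · have h := abs_sum_sub_mul_le Finset.univ lamA lamB (fun p => ⟪b p, ψ⟫ ^ 2) (fun p _ => sq_nonneg _) fun p _ => hrel p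
    have e : ∑ p, (lamA p * ⟪b p, ψ⟫ ^ 2 - lamB p * ⟪b p, ψ⟫ ^ 2) = ∑ p, (lamA p - lamB p) * ⟪b p, ψ⟫ ^ 2 :=
      Finset.sum_congr rfl fun p _ => by ring
    rw [inner_sub_right, qA, qB, ← Finset.sum_sub_distrib, e]
    exact h
  · rw [qA, ← b.sum_sq_inner_right ψ, Finset.mul_sum]
    exact Finset.sum_le_sum fun p _ => mul_le_mul_of_nonneg_right (ha p) (sq_nonneg _)
  · rw [qA]
    exact Finset.sum_nonneg fun p _ => mul_nonneg (h0A p) (sq_nonneg _)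
  · rw [qB]
    exact Finset.sum_nonneg fun p _ => mul_nonneg (h0B p) (sq_nonneg _)

end Symbol

/-! ## §3 King's symbols by name: `DeltaEff` at run lengths `k`, `k+n` (Prop. 3.10 (3.91) = `lemma43_aK`), the geometric radius, and the end-to-end producer -/
section King

variable {dd : ℕ}

/-- **★ (3.91) IN SYMBOL FORM FOR KING'S EFFECTIVE LAPLACIANS** [cite ∘ bookkeeping; NOTHING re-proved]: at nonzero Brillouin-zone momenta the symbols
`λA = Δ^{(k)} = DeltaEff (a_k) (L^k) m`, `λB = Δ^{(k+n)} = DeltaEff (a_{k+n}) (L^n·L^k) m` satisfy the four symbol hypotheses of `operatorRate_of_symbolRate` with King's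
`θ_k = a_k·2((a_n)⁻¹ + π²/48 + 1/3)·(L^k)⁻²` (`CompositionLaw.lemma43_aK`) and `a` (`DeltaEff_le` + `aK_le`; positivity `DeltaEff_pos`).
[cite: King1986, Prop 3.10 (3.91) p.669 and Lemma 4.3 (4.18) p.672] -/
theorem symbolRate_kingDeltaEff {a : ℝ} (ha : 0 < a) {L k n : ℕ} (hL : 2 ≤ L) (hk : 1 ≤ k) (hn : 1 ≤ n) {m : ℝ} (hm : 0 ≤ m)
    {P : Type*} (mom : P → Fin dd → ℝ) (hπ : ∀ i μ, |mom i μ| ≤ π) (h0 : ∀ i, 0 < momSq (mom i)) :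
    (∀ i, |DeltaEff (aK a L k) (L ^ k) m (mom i) - DeltaEff (aK a L (k + n)) (L ^ n * L ^ k) m (mom i)|
        ≤ thetaK a L k n * DeltaEff (aK a L k) (L ^ k) m (mom i)) ∧
    (∀ i, DeltaEff (aK a L k) (L ^ k) m (mom i) ≤ a) ∧ (∀ i, 0 ≤ DeltaEff (aK a L k) (L ^ k) m (mom i)) ∧
    (∀ i, 0 ≤ DeltaEff (aK a L (k + n)) (L ^ n * L ^ k) m (mom i)) := by
  have hL1 : (1 : ℝ) < L := by exact_mod_cast hL
  have hL0 : 0 < L := by omega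
  have hkn : 1 ≤ k + n := by omega
  have hNk : 1 ≤ L ^ k := Nat.one_le_pow k L hL0
  have hNkn : 1 ≤ L ^ n * L ^ k := Nat.one_le_iff_ne_zero.2 (Nat.mul_ne_zero (pow_ne_zero n (by omega)) (pow_ne_zero k (by omega)))
  refine ⟨fun i => lemma43_aK ha hL hk hn hm (hπ i) (h0 i), fun i => (DeltaEff_le (aK_pos ha hL1 hk) _ hm _).trans (aK_le ha hL1 hk),
    fun i => (DeltaEff_pos (aK_pos ha hL1 hk) hNk hm (hπ i) (h0 i)).le, fun i => (DeltaEff_pos (aK_pos ha hL1 hkn) hNkn hm (hπ i) (h0 i)).le⟩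

/-- King's relative rate is nonnegative. [folklore] -/
theorem kingTheta_nonneg {a : ℝ} (ha : 0 < a) {L k n : ℕ} (hL : 2 ≤ L) (hk : 1 ≤ k) (hn : 1 ≤ n) :
    0 ≤ thetaK a L k n := by
  have hL1 : (1 : ℝ) < L := by exact_mod_cast hL
  have h1 : 0 ≤ (aK a L n)⁻¹ := (inv_pos.2 (aK_pos ha hL1 hn)).le
  have : 0 ≤ aK a L k := (aK_pos ha hL1 hk).le
  unfold thetaK
  positivity

/-- A radius dominated by a geometric sequence along the tower is summable, and so is the binder rate `B·(e^{2r_K} − 1)` (n14-c K `summable_exp_sub_one` twin,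
inlined: `e^{x} − 1 ≤ x·e^{x}` for `x ≥ 0`). [folklore] -/
theorem summable_geometric_radius {C q : ℝ} (hC : 0 ≤ C) (hq0 : 0 ≤ q) (hq1 : q < 1) {r : ℕ → ℝ} (hr0 : ∀ K, 0 ≤ r K) (hr : ∀ K, r K ≤ C * q ^ K) (B : ℝ) :
    Summable r ∧ Summable fun K => B * (Real.exp (2 * r K) - 1) := by
  have hgeo : Summable fun K => C * q ^ K := (summable_geometric_of_lt_one hq0 hq1).mul_left C
  have hsr : Summable r := Summable.of_nonneg_of_le hr0 hr hgeo
  refine ⟨hsr, Summable.mul_left B ?_⟩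
  have hbd : ∀ K, Real.exp (2 * r K) - 1 ≤ 2 * Real.exp (2 * C) * r K := fun K => by
    have hx : 0 ≤ 2 * r K := by linarith [hr0 K]
    have hle : 2 * r K ≤ 2 * C := by
      have : q ^ K ≤ 1 := pow_le_one₀ hq0 hq1.le
      nlinarith [hr K, hr0 K]
    -- `e^x − 1 ≤ x e^x ≤ x e^{2C}`
    have h1 : Real.exp (2 * r K) - 1 ≤ 2 * r K * Real.exp (2 * r K) := by
      have := Real.add_one_le_exp (-(2 * r K))
      have hpos := Real.exp_pos (2 * r K)
      have hprod : Real.exp (-(2 * r K)) * Real.exp (2 * r K) = 1 := by rw [← Real.exp_add]; simp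
      nlinarith
    calc Real.exp (2 * r K) - 1 ≤ 2 * r K * Real.exp (2 * r K) := h1
      _ ≤ 2 * r K * Real.exp (2 * C) := mul_le_mul_of_nonneg_left (Real.exp_le_exp.2 hle) hx
      _ = 2 * Real.exp (2 * C) * r K := by ring
  exact Summable.of_nonneg_of_le (fun K => sub_nonneg.2 (Real.one_le_exp (by linarith [hr0 K]))) hbd (hsr.mul_left _)

variable {E : Type*} [NormedAddCommGroup E] [InnerProductSpace ℝ E] [MeasurableSpace E] {ι : Type*} [DecidableEq ι] {P : Type*} [Fintype P]
  {l₀ M : ℝ} {T : ℕ → Finset ι} {Bad : ℕ → ℝ → Finset ι} {μ : ℕ → ι → Measure E} {ΔA ΔB : ℕ → E →L[ℝ] E}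

/-- **★★ END TO END — DENS_cl⁰ PRODUCED IN THE KING MODEL** [folklore ∘ §1–§3]: both runs' unit-lattice effective Laplacians at tower level `K` are King's `Δ^{(k_K)}` and
`Δ^{(k_K + n)}` — diagonal in a common orthonormal Fourier basis `b` indexed by nonzero zone momenta — and the good classes' reference pieces live in the small-field class
`‖ψ‖² ≤ M`; then the vacuum densities are pointwise sandwiched with centre `0` and radius `θ_{k_K}·a·M/2` (hence `≤ θ̄·(L^{k_K})⁻²`, the tree's `thetaK_le`): the hypothesis `hD`
of n19-d's `core_dressed_of_vacuumDens` ∕ `tiltedMeanMatching_of_vacuumDens`, INHABITED in the printed model — so `core_kingModel_of_operatorRate` ∕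
`tiltedMeanMatching_kingModel_of_operatorRate` deliver N19's dressed `Core` and N14's binder there with a summable `δ`∕`η` (`summable_geometric_radius`). -/
theorem vacuumDens_kingModel {a : ℝ} (ha : 0 < a) {L n : ℕ} (hL : 2 ≤ L) (hn : 1 ≤ n) {m : ℝ} (hm : 0 ≤ m) (kA : ℕ → ℕ) (hk : ∀ K, 1 ≤ kA K)
    (b : OrthonormalBasis P ℝ E) (mom : P → Fin dd → ℝ) (hπ : ∀ i μ, |mom i μ| ≤ π) (h0 : ∀ i, 0 < momSq (mom i))
    (hdA : ∀ K p ψ, ⟪b p, ΔA K ψ⟫ = DeltaEff (aK a L (kA K)) (L ^ kA K) m (mom p) * ⟪b p, ψ⟫)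
    (hdB : ∀ K p ψ, ⟪b p, ΔB K ψ⟫ = DeltaEff (aK a L (kA K + n)) (L ^ n * L ^ kA K) m (mom p) * ⟪b p, ψ⟫)
    (hsupp : ∀ (K : ℕ) (t : ℝ), |t| ≤ l₀ → ∀ τ ∈ T K \ Bad K t, ∀ᵐ ψ ∂(μ K τ), ‖ψ‖ ^ 2 ≤ M) :
    ∀ K : ℕ, ∃ c : ℝ, ∀ t : ℝ, |t| ≤ l₀ → ∀ τ ∈ T K \ Bad K t, ∀ᵐ ψ ∂(μ K τ),
      Real.exp (c - thetaK a L (kA K) n * a * M / 2) *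
          Real.exp (-(⟪ψ, ΔA K ψ⟫ / 2)) ≤ Real.exp (-(⟪ψ, ΔB K ψ⟫ / 2)) ∧
        Real.exp (-(⟪ψ, ΔB K ψ⟫ / 2)) ≤
          Real.exp (c + thetaK a L (kA K) n * a * M / 2) *
            Real.exp (-(⟪ψ, ΔA K ψ⟫ / 2)) := by
  have hop : ∀ K, (∀ ψ, |⟪ψ, ΔA K ψ - ΔB K ψ⟫| ≤
      thetaK a L (kA K) n * ⟪ψ, ΔA K ψ⟫) ∧
      (∀ ψ, ⟪ψ, ΔA K ψ⟫ ≤ a * ‖ψ‖ ^ 2) ∧ (∀ ψ, 0 ≤ ⟪ψ, ΔA K ψ⟫) ∧ (∀ ψ, 0 ≤ ⟪ψ, ΔB K ψ⟫) := fun K => by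
    obtain ⟨h1, h2, h3, h4⟩ := symbolRate_kingDeltaEff ha hL (hk K) hn hm mom hπ h0
    exact operatorRate_of_symbolRate b (hdA K) (hdB K) h1 h2 h3 h4
  exact vacuumDens_of_operatorRate (μ := μ) (θ := fun K => thetaK a L (kA K) n)
    (r := fun K => thetaK a L (kA K) n * a * M / 2)
    (fun K => kingTheta_nonneg ha hL (hk K) hn) (fun K => (hop K).1) (fun K => (hop K).2.1) ha.le hsupp fun K => le_rfl

/-- **★★ N14's BINDER IN KING'S MODEL, END TO END** [folklore ∘ §1–§3 + n19-d `tiltedMeanMatching_of_vacuumDens`]: under the hypotheses of `vacuumDens_kingModel` (plus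
`0 ≤ M`, finite reference pieces on the classes, a `B`-bounded measurable unit-scale observable family `W`), the two runs' dressed class laws satisfy
`TiltedMeanMatching l₀ T Bad W (run A) W (run B) (K ↦ B·(e^{θ_{k_K}·a·M} − 1))`. -/
theorem tiltedMeanMatching_kingModel [BorelSpace E] {a : ℝ} (ha : 0 < a) {L n : ℕ} (hL : 2 ≤ L) (hn : 1 ≤ n) {m : ℝ} (hm : 0 ≤ m)
    (kA : ℕ → ℕ) (hk : ∀ K, 1 ≤ kA K) (b : OrthonormalBasis P ℝ E) (mom : P → Fin dd → ℝ) (hπ : ∀ i μ, |mom i μ| ≤ π)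
    (h0 : ∀ i, 0 < momSq (mom i)) (hdA : ∀ K p ψ, ⟪b p, ΔA K ψ⟫ = DeltaEff (aK a L (kA K)) (L ^ kA K) m (mom p) * ⟪b p, ψ⟫)
    (hdB : ∀ K p ψ, ⟪b p, ΔB K ψ⟫ = DeltaEff (aK a L (kA K + n)) (L ^ n * L ^ kA K) m (mom p) * ⟪b p, ψ⟫) (hM : 0 ≤ M)
    (hsupp : ∀ (K : ℕ) (t : ℝ), |t| ≤ l₀ → ∀ τ ∈ T K \ Bad K t, ∀ᵐ ψ ∂(μ K τ), ‖ψ‖ ^ 2 ≤ M) (hfin : ∀ K, ∀ τ ∈ T K, IsFiniteMeasure (μ K τ))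
    {B : ℝ} (hB : 0 ≤ B) {W : ℕ → E → ℝ} (hWm : ∀ K, Measurable (W K)) (hWb : ∀ K ψ, |W K ψ| ≤ B) :
    TiltedMeanMatching l₀ T Bad W (fun K τ => (μ K τ).withDensity fun ψ => ENNReal.ofReal (Real.exp (-(⟪ψ, ΔA K ψ⟫ / 2)))) W
      (fun K τ => (μ K τ).withDensity fun ψ => ENNReal.ofReal (Real.exp (-(⟪ψ, ΔB K ψ⟫ / 2)))) fun K =>
        B * (Real.exp (2 * (thetaK a L (kA K) n * a * M / 2)) - 1) := by
  have hop : ∀ K, (∀ ψ, |⟪ψ, ΔA K ψ - ΔB K ψ⟫| ≤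
      thetaK a L (kA K) n * ⟪ψ, ΔA K ψ⟫) ∧
      (∀ ψ, ⟪ψ, ΔA K ψ⟫ ≤ a * ‖ψ‖ ^ 2) ∧ (∀ ψ, 0 ≤ ⟪ψ, ΔA K ψ⟫) ∧ (∀ ψ, 0 ≤ ⟪ψ, ΔB K ψ⟫) := fun K => by
    obtain ⟨h1, h2, h3, h4⟩ := symbolRate_kingDeltaEff ha hL (hk K) hn hm mom hπ h0
    exact operatorRate_of_symbolRate b (hdA K) (hdB K) h1 h2 h3 h4
  exact tiltedMeanMatching_kingModel_of_operatorRate (μ := μ)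
    (θ := fun K => thetaK a L (kA K) n)
    (r := fun K => thetaK a L (kA K) n * a * M / 2)
    (fun K => kingTheta_nonneg ha hL (hk K) hn) (fun K => (hop K).1) (fun K => (hop K).2.1) ha.le hM (fun K => (hop K).2.2.1) hsupp
    (fun K => le_rfl) hfin hB hWm hWb

/-- **… WITH A SUMMABLE RATE** for consecutive run lengths `k_K = K + 1` [folklore ∘ the tree's `thetaK_le` + `summable_geometric_radius`]: the radius
`r_K = θ_{K+1}·a·M/2 ≤ (a²·c₀·M·L⁻²)·(L⁻²)^K` is geometric, so `Σ_K r_K < ∞` (N19's `Summable δ` at `δ_K = r_K/vol`) and `Σ_K B·(e^{2r_K} − 1) < ∞` (N14's `Summable η`). -/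
theorem summable_kingRadius {a : ℝ} (ha : 0 < a) {L n : ℕ} (hL : 2 ≤ L) (hn : 1 ≤ n) {M : ℝ} (hM : 0 ≤ M) (B : ℝ) :
    (Summable fun K : ℕ => thetaK a L (K + 1) n * a * M / 2) ∧
    Summable fun K : ℕ => B * (Real.exp (2 * (thetaK a L (K + 1) n * a * M / 2)) - 1) := by
  have hL1 : (1 : ℝ) < L := by exact_mod_cast hL
  set q : ℝ := ((L : ℝ) ^ 2)⁻¹ with hq
  have hq0 : 0 ≤ q := inv_nonneg.2 (sq_nonneg _)
  have hq1 : q < 1 := inv_lt_one_of_one_lt₀ (by nlinarith)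
  have hθbar : 0 ≤ thetaBar a L := by
    have := (inv_pos.2 (aminL_pos ha hL)).le
    unfold thetaBar
    positivity
  refine summable_geometric_radius (C := thetaBar a L * a * M / 2 * q) (by positivity) hq0 hq1
    (fun K => div_nonneg (mul_nonneg (mul_nonneg (kingTheta_nonneg ha hL (by omega) hn) ha.le) hM) two_pos.le) (fun K => ?_) B
  -- `θ_{K+1} ≤ θ̄·(L^{K+1})⁻² = θ̄·q^K·q` (tree `thetaK_le`)
  have hθ := thetaK_le ha hL (k := K + 1) (n := n) (by omega) hn
  have hpow : ((((L : ℝ)) ^ (K + 1)) ^ 2)⁻¹ = q ^ K * q := by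
    rw [hq, ← pow_succ, ← inv_pow]
    ring
  rw [hpow] at hθ
  have haM : 0 ≤ a * M / 2 := by positivity
  calc thetaK a L (K + 1) n * a * M / 2 = thetaK a L (K + 1) n * (a * M / 2) := by ring
    _ ≤ thetaBar a L * (q ^ K * q) * (a * M / 2) := mul_le_mul_of_nonneg_right hθ haM
    _ = thetaBar a L * a * M / 2 * q * q ^ K := by ring

end King

end YMDAG.N18.KingModelDens

end
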